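import Literature.NumberTheory.Automorphic.ArtinLFunctionsCyclicHeckeFactorisation
import Literature.NumberTheory.GaloisRepresentations.GlobalArtinMapAbstractExtensionProofs
import Literature.NumberTheory.NumberFields.ArithmeticEquivalenceProofs
import Literature.NumberTheory.LFunctions.RayClassPartialZetaResidue
import Literature.NumberTheory.LFunctions.DedekindZetaEntireConvexity
import HarnessLib

/-!
# The Hecke factorisation of `ζ_N` for an abstract cyclic extension `N|E`: primitive characters, conductors,
# entire continuations and the transfer of zeros

Topic `Literature/NumberTheory/LFunctions`; namespace `Literature.NumberTheory.LFunctions.CyclicExtension`.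
Pure-proof file; the finite-level (ideal-theoretic) form of
`Automorphic/ArtinLFunctionsCyclicHeckeFactorisation.lean`, transported from an embedded copy `L ⊆ Ē`
to an ABSTRACT finite cyclic Galois extension `N|E` of number fields (`embeddedField`, `galFrob_embeddedField_eq`).

> **Neukirch VII (10.6) with Remark, (10.4) (iv), (11.9) Corollary; (8.6) with Remark 1; (5.10).**  For `N|E`
> cyclic of degree `n` with a faithful character `χ₁` of `G(N|E)`: `ζ_N(s) = ∏_{j<n} L(χ_j, s)` with `χ_j` the
> primitive Größencharakter `mod 𝔣_j` with `χ_j(𝔭) = χ₁(φ_𝔭)^j` at the unramified `𝔭`; `∏_j |d_E| 𝔑𝔣_j = |d_N|`;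
> each `L(χ_j, s)`, `n ∤ j`, is entire (Hecke).  Consequently `(s-1)ζ_N(s) = (s-1)ζ_E(s) · ∏_{0<j<n} L(χ_j, s)`
> on all of `ℂ`, and every zero of an `L(χ_j, ·)` is a zero of `(s-1)ζ_N(s)`, with multiplicities adding up
> (Aramata–Brauer divisibility `ζ_E ∣ ζ_N` in the cyclic case).

Results (`E N : Type`, `[IsGalois E N] [IsCyclic (N ≃ₐ[E] N)]`, `n = [N:E]`):

* `exists_primitive_heckeFactorisation` — the data `χ₁, 𝔣_j, χ_j, p_j` with: primitivity and sign types;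
  `χ_j(v) = χ₁(galFrob E N v)^j` for `v` unramified in `N`; primes dividing `𝔣_j` ramify in `N`; `𝔣_0 = (1)`,
  `χ_0 = 1`; `χ_j` non-principal for `n ∤ j`; `ζ_N(s) = ∏_{j<n} L(χ_j, s)` (`re s > 1`);
  `∏_{j<n} |d_E| 𝔑𝔣_j = |d_N|`; entire continuations `L_j` (`n ∤ j`) with
  `ζ₁_N(s) = ζ₁_E(s) ∏_{0<j<n} L_j(s)` for ALL `s` (`ζ₁_K(s) = (s-1)ζ_K(s)`, the tree's `dedekindZeta₁`), and
  `ord_ρ ζ₁_N = ord_ρ ζ₁_E + ∑_{0<j<n} ord_ρ L_j` at every `ρ`;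
* `rayClassLSeries_top_one_eq_dedekindZeta` — `L(𝟙 mod (1), s) = ζ_E(s)` for `re s > 1`.

## References

* J. Neukirch, *Algebraic Number Theory*, Springer 1999, Ch. VII §10 Thm. (10.6) with Remark, Prop. (10.4);
  §11 (11.9) Corollary; §8 (8.1), Thm. (8.5), Cor. (8.6) with Remark 1; §5 Cor. (5.10). [NeukirchANT1999]
-/

noncomputable section

open scoped NumberField
open Field IsDedekindDomain NumberField NumberField.InfinitePlace Complex Filter Topology
open Literature.NumberTheory.GaloisRepresentations Literature.NumberTheory.Automorphic

namespace Literature.NumberTheory.LFunctions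

/-! ### `L(𝟙 mod (1), s) = ζ_E(s)` -/

section Trivial

variable {E : Type*} [Field E] [NumberField E]

/-- **The L-series of the trivial character modulo `(1)` is the Dedekind zeta function**: for `re s > 1`,
`L(𝟙, s) = ∑_{𝔞 ≠ 0} 𝔑𝔞^{-s} = ζ_E(s)`. [cite: NeukirchANT1999, Ch. VII §8 (8.1) and §5 (5.2)] -/
theorem rayClassLSeries_top_one_eq_dedekindZeta {s : ℂ} (hs : 1 < s.re) :
    rayClassLSeries (⊤ : Ideal (𝓞 E)) (fun _ ↦ (1 : ℂ)) s = NumberField.dedekindZeta E s := by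
  classical
  have hs0 : -s ≠ 0 := neg_ne_zero.mpr fun h ↦ by rw [h, Complex.zero_re] at hs; linarith
  rw [rayClassLSeries, ← (hasSum_absNorm_cpow E hs).tsum_eq]
  refine tsum_congr fun I ↦ ?_
  by_cases hI : I = ⊥
  · rw [hI, rayClassCoeff_bot, zero_mul, Ideal.absNorm_bot, Nat.cast_zero, Complex.zero_cpow hs0]
  · have hcop : IsCoprime I (⊤ : Ideal (𝓞 E)) := by rw [← Ideal.one_eq_top]; exact isCoprime_one_right
    have h1 : idealPow E (fun _ ↦ (1 : ℂ)) I = 1 := by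
      unfold idealPow
      exact finprod_eq_one_of_forall_eq_one fun v ↦ one_pow _
    rw [rayClassCoeff, if_pos ⟨hI, hcop⟩, h1, one_mul]

end Trivial

/-! ### Orders of finite products of analytic functions -/

section Orders

/-- The order of vanishing of a finite product of functions analytic at `z₀`, none of them locally zero there,
is the sum of the orders. [folklore] -/
private theorem analyticOrderNatAt_finset_prod {ι : Type*} (S : Finset ι) (f : ι → ℂ → ℂ) (z₀ : ℂ)
    (hf : ∀ i ∈ S, AnalyticAt ℂ (f i) z₀) (hne : ∀ i ∈ S, analyticOrderAt (f i) z₀ ≠ ⊤) :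
    analyticOrderNatAt (∏ i ∈ S, f i) z₀ = ∑ i ∈ S, analyticOrderNatAt (f i) z₀ ∧
      analyticOrderAt (∏ i ∈ S, f i) z₀ ≠ ⊤ := by
  classical
  induction S using Finset.induction_on with
  | empty =>
    refine ⟨?_, ?_⟩
    · rw [Finset.prod_empty, Finset.sum_empty]
      have : analyticOrderAt (1 : ℂ → ℂ) z₀ = 0 := by
        rw [analyticOrderAt_eq_zero]; exact Or.inr one_ne_zero
      simp [analyticOrderNatAt, this]
    · rw [Finset.prod_empty, ne_eq, analyticOrderAt_eq_top, Filter.eventually_iff_exists_mem]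
      rintro ⟨U, hU, h⟩
      exact one_ne_zero (h z₀ (mem_of_mem_nhds hU))
  | insert i S hi ih =>
    have hfi := hf i (Finset.mem_insert_self i S)
    have hnei := hne i (Finset.mem_insert_self i S)
    obtain ⟨ih1, ih2⟩ := ih (fun k hk ↦ hf k (Finset.mem_insert_of_mem hk)) (fun k hk ↦ hne k (Finset.mem_insert_of_mem hk))
    have hprod : AnalyticAt ℂ (∏ k ∈ S, f k) z₀ :=
      Finset.analyticAt_prod S (fun k hk ↦ hf k (Finset.mem_insert_of_mem hk))
    rw [Finset.prod_insert hi, Finset.sum_insert hi]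
    refine ⟨?_, ?_⟩
    · rw [analyticOrderNatAt_mul hfi hprod hnei ih2, ih1]
    · rw [analyticOrderAt_mul hfi hprod]
      exact WithTop.add_ne_top.mpr ⟨hnei, ih2⟩

/-- An entire function which does not vanish at some point is nowhere locally zero. [folklore] -/
private theorem analyticOrderAt_ne_top_of_entire {f : ℂ → ℂ} (hf : Differentiable ℂ f) {z₁ : ℂ} (hz₁ : f z₁ ≠ 0)
    (z₀ : ℂ) : analyticOrderAt f z₀ ≠ ⊤ := by
  intro htop
  rw [analyticOrderAt_eq_top] at htop
  have hall := ((hf.differentiableOn.analyticOnNhd isOpen_univ).eqOn_zero_of_preconnected_of_eventuallyEq_zero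
    isPreconnected_univ (Set.mem_univ z₀) htop) (Set.mem_univ z₁)
  exact hz₁ hall

end Orders

/-! ### The main theorem -/

namespace CyclicExtension

variable (E N : Type) [Field E] [NumberField E] [Field N] [NumberField N] [Algebra E N]
  [IsGalois E N] [IsCyclic (N ≃ₐ[E] N)]

/-- **Hecke factorisation of `ζ_N` for a cyclic extension `N|E` of number fields, with primitive characters,
conductor–discriminant formula, entire continuations and transfer of zeros** (Neukirch VII (10.6) with Remark,
(10.4) (iv), (11.9) Corollary, (8.6)).  See the module docstring for the list of clauses.
[cite: NeukirchANT1999, Ch. VII §10 Thm. (10.6) (Remark); Prop. (10.4) (iv); §11 (11.9) Corollary; §8 Cor. (8.6)] -/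
theorem exists_primitive_heckeFactorisation :
    ∃ (χ₁ : (N ≃ₐ[E] N) →* ℂˣ) (𝔣 : ℕ → Ideal (𝓞 E)) (χ : ℕ → HeightOneSpectrum (𝓞 E) → ℂ)
      (p : ℕ → Finset {w : InfinitePlace E // w.IsReal}) (L : ℕ → ℂ → ℂ),
      Function.Injective χ₁ ∧
      (∀ j, 𝔣 j ≠ ⊥ ∧ IsRayClassCharacter (𝔣 j) (χ j) ∧ IsPrimitive (𝔣 j) (χ j) ∧ IsSignType (𝔣 j) (χ j) (p j)) ∧
      (∀ (j : ℕ) (v : HeightOneSpectrum (𝓞 E)), 𝔣 j ≤ v.asIdeal → ¬ Algebra.IsUnramifiedIn (𝓞 N) v.asIdeal) ∧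
      (∀ (j : ℕ) (v : HeightOneSpectrum (𝓞 E)), Algebra.IsUnramifiedIn (𝓞 N) v.asIdeal →
        χ j v = ((χ₁ (galFrob E N v) : ℂˣ) : ℂ) ^ j) ∧
      𝔣 0 = ⊤ ∧ (∀ v : HeightOneSpectrum (𝓞 E), χ 0 v = 1) ∧
      (∀ j : ℕ, ¬ Module.finrank E N ∣ j → ∃ v : HeightOneSpectrum (𝓞 E), ¬ 𝔣 j ≤ v.asIdeal ∧ χ j v ≠ 1) ∧
      (∀ s : ℂ, 1 < s.re → NumberField.dedekindZeta N s =
        ∏ j ∈ Finset.range (Module.finrank E N), rayClassLSeries (𝔣 j) (χ j) s) ∧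
      ∏ j ∈ Finset.range (Module.finrank E N), ((NumberField.discr E).natAbs * Ideal.absNorm (𝔣 j)) =
        (NumberField.discr N).natAbs ∧
      (∀ j : ℕ, ¬ Module.finrank E N ∣ j →
        Differentiable ℂ (L j) ∧ ∀ s : ℂ, 1 < s.re → L j s = rayClassLSeries (𝔣 j) (χ j) s) ∧
      (∀ s : ℂ, dedekindZeta₁ N s = dedekindZeta₁ E s * ∏ j ∈ Finset.Ico 1 (Module.finrank E N), L j s) ∧
      (∀ ρ : ℂ, analyticOrderNatAt (dedekindZeta₁ N) ρ =
        analyticOrderNatAt (dedekindZeta₁ E) ρ + ∑ j ∈ Finset.Ico 1 (Module.finrank E N), analyticOrderNatAt (L j) ρ) := by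
  classical
  -- the embedded copy `L₀ ⊆ Ē` of `N`
  haveI : FiniteDimensional E N := Module.Finite.of_restrictScalars_finite ℚ E N
  haveI : IsMulCommutative (N ≃ₐ[E] N) := ⟨⟨fun a b ↦ IsCyclic.commGroup.mul_comm a b⟩⟩
  haveI : IsAbelianGalois E N := ⟨⟩
  set L₀ := embeddedField E N with hL₀
  set e : N ≃ₐ[E] L₀ := embeddedEquiv E N with he
  haveI : IsCyclic (L₀ ≃ₐ[E] L₀) := isCyclic_of_surjective e.autCongr.toMonoidHom e.autCongr.surjective
  obtain ⟨χ₁', 𝔣, χ, p, hinj, hdata, hsupp, hval, h𝔣0, hχ0, hnt, hζ, hdisc, -⟩ :=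
    Automorphic.exists_primitive_heckeFactorisation_of_isCyclic L₀
  have hdeg : Module.finrank E L₀ = Module.finrank E N := finrank_embeddedField E N
  set n := Module.finrank E N with hn
  have h1n : 1 ≤ n := Module.finrank_pos
  rw [hdeg] at hnt hζ hdisc
  -- the entire continuations (Hecke)
  have hcont : ∀ j : ℕ, ∃ Lj : ℂ → ℂ, ¬ n ∣ j →
      Differentiable ℂ Lj ∧ ∀ s : ℂ, 1 < s.re → Lj s = rayClassLSeries (𝔣 j) (χ j) s := by
    intro j
    by_cases hj : n ∣ j
    · exact ⟨0, fun h ↦ (h hj).elim⟩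
    · obtain ⟨Lj, hLj, hLjs⟩ := exists_differentiable_eq_rayClassLSeries (hdata j).1 (hdata j).2.1 (hnt j hj)
      exact ⟨Lj, fun _ ↦ ⟨hLj, hLjs⟩⟩
  choose Lc hLc using hcont
  -- the factorisation on `re s > 1`, transported to `N`
  have hζN : ∀ s : ℂ, 1 < s.re → NumberField.dedekindZeta N s = ∏ j ∈ Finset.range n, rayClassLSeries (𝔣 j) (χ j) s := by
    intro s hs
    rw [← hζ s hs, (Literature.NumberTheory.NumberFields.ArithmeticallyEquivalent.of_algEquiv (e.restrictScalars ℚ)).dedekindZeta_eq]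
  -- the entire identity `ζ₁_N = ζ₁_E ∏_{0<j<n} L_j`
  have hχ0' : χ 0 = fun _ ↦ (1 : ℂ) := funext hχ0
  have hright : Differentiable ℂ fun s ↦ dedekindZeta₁ E s * ∏ j ∈ Finset.Ico 1 n, Lc j s := by
    refine (dedekindZeta₁_differentiable E).mul (Differentiable.fun_finsetProd fun j hj ↦ ?_)
    rw [Finset.mem_Ico] at hj
    exact (hLc j (fun h ↦ by have := Nat.le_of_dvd (by omega) h; omega)).1
  have hident : ∀ s : ℂ, dedekindZeta₁ N s = dedekindZeta₁ E s * ∏ j ∈ Finset.Ico 1 n, Lc j s := by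
    have hev : ∀ᶠ z in 𝓝 (2 : ℂ), dedekindZeta₁ N z = dedekindZeta₁ E z * ∏ j ∈ Finset.Ico 1 n, Lc j z := by
      refine eventually_of_mem ((continuous_re.isOpen_preimage _ isOpen_Ioi).mem_nhds (by simp : 1 < (2 : ℂ).re))
        fun z (hz : 1 < z.re) ↦ ?_
      rw [dedekindZeta₁_apply_eq_mul hz, dedekindZeta₁_apply_eq_mul hz, hζN z hz, Finset.range_eq_Ico,
        Finset.prod_eq_prod_Ico_succ_bot h1n, h𝔣0, hχ0', rayClassLSeries_top_one_eq_dedekindZeta hz, mul_assoc]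
      congr 2
      refine Finset.prod_congr rfl fun j hj ↦ ?_
      rw [Finset.mem_Ico] at hj
      exact ((hLc j (fun h ↦ by have := Nat.le_of_dvd (by omega) h; omega)).2 z hz).symm
    have h := ((dedekindZeta₁_differentiable N).differentiableOn.analyticOnNhd isOpen_univ).eqOn_of_preconnected_of_eventuallyEq
      (hright.differentiableOn.analyticOnNhd isOpen_univ) isPreconnected_univ (Set.mem_univ (2 : ℂ)) hev
    exact fun s ↦ h (Set.mem_univ s)
  -- orders of vanishing add up
  have hN2 : dedekindZeta₁ N 2 ≠ 0 := by
    rw [dedekindZeta₁_apply_eq_mul (by norm_num : 1 < (2 : ℂ).re)]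
    exact mul_ne_zero (by norm_num) (NumberField.dedekindZeta_ne_zero_of_one_lt_re N (by norm_num))
  have horders : ∀ ρ : ℂ, analyticOrderNatAt (dedekindZeta₁ N) ρ =
      analyticOrderNatAt (dedekindZeta₁ E) ρ + ∑ j ∈ Finset.Ico 1 n, analyticOrderNatAt (Lc j) ρ := by
    intro ρ
    have hfun : dedekindZeta₁ N = dedekindZeta₁ E * ∏ j ∈ Finset.Ico 1 n, Lc j := by
      funext s; rw [hident s, Pi.mul_apply, Finset.prod_apply]
    have hNtop : analyticOrderAt (dedekindZeta₁ N) ρ ≠ ⊤ :=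
      analyticOrderAt_ne_top_of_entire (dedekindZeta₁_differentiable N) hN2 ρ
    have hEan : AnalyticAt ℂ (dedekindZeta₁ E) ρ := (dedekindZeta₁_differentiable E).analyticAt ρ
    have hLan : ∀ j ∈ Finset.Ico 1 n, AnalyticAt ℂ (Lc j) ρ := fun j hj ↦ by
      rw [Finset.mem_Ico] at hj
      exact (hLc j (fun h ↦ by have := Nat.le_of_dvd (by omega) h; omega)).1.analyticAt ρ
    have hPan : AnalyticAt ℂ (∏ j ∈ Finset.Ico 1 n, Lc j) ρ := Finset.analyticAt_prod _ hLan
    rw [hfun] at hNtop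
    have hsplit := analyticOrderAt_mul hEan hPan
    rw [hsplit] at hNtop
    obtain ⟨hEtop, hPtop⟩ := WithTop.add_ne_top.mp hNtop
    -- each `L_j` has finite order (else the product would be locally zero)
    have hLtop : ∀ j ∈ Finset.Ico 1 n, analyticOrderAt (Lc j) ρ ≠ ⊤ := by
      intro j hj htop
      refine hPtop (analyticOrderAt_eq_top.mpr ?_)
      filter_upwards [analyticOrderAt_eq_top.mp htop] with z hz
      rw [Finset.prod_apply]
      exact Finset.prod_eq_zero hj hz
    obtain ⟨hP1, -⟩ := analyticOrderNatAt_finset_prod (Finset.Ico 1 n) Lc ρ hLan hLtop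
    rw [hfun, analyticOrderNatAt_mul hEan hPan hEtop hPtop, hP1]
  -- assembling
  refine ⟨χ₁'.comp e.autCongr.toMonoidHom, 𝔣, χ, p, Lc, hinj.comp e.autCongr.injective, hdata,
    fun j v hle hunr ↦ hsupp j v hle ((isUnramifiedIn_embeddedField_iff v).mpr hunr), fun j v hunr ↦ ?_,
    h𝔣0, hχ0, hnt, hζN, ?_, hLc, hident, horders⟩
  · rw [hval j v ((isUnramifiedIn_embeddedField_iff v).mpr hunr), galFrob_embeddedField_eq hunr]
    rfl
  · rw [hdisc, NumberField.discr_eq_discr_of_algEquiv N (e.restrictScalars ℚ)]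

end CyclicExtension

end Literature.NumberTheory.LFunctions
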